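import Summits.ABC.IUTFork.Repair.RHHullCapacityNecessaryLin
import HarnessLib

/-!
# IUT REPAIR branch → R-H ROUND 1, ROW 3 «hull-capacity-necessary»: the k2 TEST of BOTH typings ([ED] `RHHullCapacityNecessaryTyped.HStar`,
# p458118; [LIN] `RHHullCapacityNecessaryLin.HStarLin`, p459252) against the UNRAMIFIED-ODD stratum — H⋆₃ is FALSE there, with the SAME SIGN as
# the landed refutation family, and through the row's own necessity glue this re-derives `¬Licence` at such data

PROOF-ONLY (0 definitions, 0 `Prop` facts, no instance, no notation; abc-iut cell, rung LADDER-ABC:A2.RESCUE.H; seat abc-iut-rh-tst-3 = R-H ROUND 1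
PAIR n = 3 TESTER, director-abc W13 (A) item k2 «does H⋆₃ survive the unramified-odd refutation family that killed I06⋆ as typed»). TAKES NO SIDE on
[IUTchIII] Cor. 3.12 or on any author; H⋆₃ in either typing is a HYPOTHESIS about OUR typed objects; typed ≠ proved; instantiated ≠ endorsed.

THE STRATUM: a bad place `w | p` of the genuine `K`-level datum `pilotDataOfK D K` with `p > 2` and `e(w|p) = 1`, carrying `P_q(w) = m ≥ 1`. There the
[IUTchIV] Prop. 1.2 constants are `a = 1`, `b = −1` (`Literature.IUT.LogVolume.logRadiusA_eq` / `logRadiusB_eq` at `e = 1 ≤ p − 2`) and `d = (e−1)/e = 0`,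
so `d + a + b = 0`. The «unramified-odd refutation family» = `Repair.CandInternal2Real.not_mem_jsq_smul_logShell_of_unramified` (`q̲ ∉ q̲^{j²}·𝓘` for
`j ≥ 2`), `Repair.CandInternal2RealStrata.not_mem_of_lt_odd`, `Repair.EvalHonestCeiling.i06_false_of_honest` (¬I06⋆): every member REFUTES on this stratum.

FINDING (every clause a theorem below, one-line instances BY NAME of the row's own deciding lemmas):
* §1 [LIN]: the cell reads `(j²−1)·m ≤ 1`, FALSE for every label `j ≥ 2` (`not_cellLinAt_pilotDataOfK_of_unramified_odd`, via p459252's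
  `cellLinAt_pilotDataOfK_iff_of_not_dvd`); hence `¬HStarLin (pilotDataOfK D K)` as soon as the datum has ONE such bad place — the label `j = 2` exists by
  `two_le_lstar` (`not_hStarLin_pilotDataOfK_of_unramified_odd`).
* §2 [ED]: the cell reads `⌊j²m − (j+1)⌋ ≤ m`, i.e. `(j−1)·m ≤ 1`, FALSE for every label `j ≥ 3` (`not_cellAt_pilotDataOfK_of_unramified_odd`, via p458118's
  `cellAt_pilotDataOfK_iff_of_not_dvd`; at `j = 2` it holds iff `m = 1` — the [ED] container is the larger one); hence `¬HStar (pilotDataOfK D K) hlog` whenever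
  `l⋆ ≥ 3` (`not_hStar_pilotDataOfK_of_unramified_odd`).
* §3 SAME SIGN AS THE FAMILY, through the row's OWN glue (p459252 `not_licence_of_not_cellLinAt`): at such a datum the (xi-f) licence at `settingPrVolSharp`
  with REALISING ideles is refuted (`not_licence_settingPrVolSharp_of_unramified_odd`) — H⋆₃ reproduces the family's verdict on the stratum instead of
  contradicting it; as a stand-alone (sufficient) hypothesis it would be dead there, which is immaterial for a NECESSARY condition (ROUND1 row 3 word:
  «KILL(k1) HEX-all + WINDOW-LOCATOR(HEX: k ≤ 8) = the necessary condition of record»).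
Table witness: R-W WINDOW-TABLE v1 4ab7aaa66306c0ce synthetic row `S-RAT` (`p = 7`, `e_w = 1`, `m_q = 1`): label `j = 1` INHABITED / cell TRUE, `j = 2` REFUTED /
cell FALSE (tester harness HOME/abc-iut-rh-tst-3/row3_probe4_lin_allstrata.py: 0/3250 packets with a cell TRUE where R-W refutes, 0/3250 with a cell FALSE
where R-W certifies INHABITED). [cite: Mochizuki2012, IUTchIV Prop. 1.2 (i)(ii) pp. 10–11] [cite: SerreLocalFields1979, Ch. III §6 Prop. 13]
[claim: Mochizuki2012, status: disputed]
-/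

noncomputable section

open Set Function NumberField IsDedekindDomain
open scoped Pointwise

namespace Summit.ABC.IUTFork.Repair.RHHullCapacityNecessaryLinUnram

open Literature.AnabelianGeometry.AbsoluteAnabelian Literature.IUT.LogThetaLattice Literature.IUT.LogVolume
  Literature.IUT.HodgeTheaters Literature.NumberTheory.NumberFields Literature.NumberTheory.GaloisRepresentations.Ultrametric
open Summit.ABC.IUTFork.Thm311 Summit.ABC.IUTFork.Thm311.Real Summit.ABC.IUTFork.Cor312 Summit.ABC.IUTFork.Cor312.Setting
  Summit.ABC.IUTFork.Cor312Vol Summit.ABC.IUTFork.Cor312Vol.ExplicitDepth Summit.ABC.IUTFork.Cor312Prov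
  Summit.ABC.IUTFork.Repair.RHHullCapacityNecessary Summit.ABC.IUTFork.Repair.RHHullCapacityNecessaryTyped
  Summit.ABC.IUTFork.Repair.RHHullCapacityNecessaryLin

/-! ## §1–§2. Both cells are FALSE on the unramified odd stratum of the genuine datum -/

section Genuine

variable {F K Fbar : Type} [Field F] [NumberField F] [Field K] [NumberField K] [Algebra F K] [Field Fbar]
  [Algebra F Fbar] [Algebra K Fbar] {E : WeierstrassCurve F} [E.IsElliptic] {l : ℕ} {Pb : BadPlacePredicates K}
  (D : InitialThetaData F K Fbar E l Pb) {logv : PadicLogs K} (hlog : LogvAnalytic logv)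

/-- **H⋆₃[LIN] CELL FAILS on the unramified odd stratum**: at a place `w | p` of the genuine datum with `p > 2`, `e(w|p) = 1`, `P_q(w) = m ≥ 1`, every label
`j = i₀ + 1 ≥ 2` has `¬ CellLinAt` (the cell reads `(j²−1)·m ≤ 1`). [folklore] -/
theorem not_cellLinAt_pilotDataOfK_of_unramified_odd (pp : Nat.Primes) (hp : 2 < (pp : ℕ))
    (i₀ : Fin (thetaIndex (pilotDataOfK D K)).lstar) (hi : 1 ≤ (i₀ : ℕ))
    (w : (thetaIndex (pilotDataOfK D K)).Fibre (.inr pp)) {m : ℕ} (hm : 1 ≤ m)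
    (hram : haveI : Fact (pp : ℕ).Prime := ⟨pp.2⟩; (placeOf (pilotDataOfK D K) pp.1 w).asIdeal.ramificationIdx ℤ = 1)
    (hP : haveI : Fact (pp : ℕ).Prime := ⟨pp.2⟩; (pilotDataOfK D K).qPilot (placeOf (pilotDataOfK D K) pp.1 w) = (m : ℝ)) :
    ¬ CellLinAt (pilotDataOfK D K) pp i₀ w := by
  have hnd : ¬ (pp : ℕ) ∣ 1 := by
    intro h
    have := Nat.le_of_dvd one_pos h
    omega
  rw [cellLinAt_pilotDataOfK_iff_of_not_dvd D pp i₀ w hram hnd hP]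
  have h1 : (1 : ℕ) ≤ (pp : ℕ) - 2 := by omega
  rw [logRadiusA_eq hp le_rfl h1, logRadiusB_eq hp le_rfl h1]
  have hi' : (1 : ℝ) ≤ ((i₀ : ℕ) : ℝ) := by exact_mod_cast hi
  have hm' : (1 : ℝ) ≤ (m : ℝ) := by exact_mod_cast hm
  have h3 : (3 : ℝ) ≤ (((i₀ : ℕ) + 1 : ℕ) : ℝ) ^ 2 - 1 := by push_cast; nlinarith
  have h4 : (3 : ℝ) * 1 ≤ ((((i₀ : ℕ) + 1 : ℕ) : ℝ) ^ 2 - 1) * (m : ℝ) := mul_le_mul h3 hm' zero_le_one (by linarith)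
  simp only [Nat.cast_one, div_one, sub_self]
  intro h
  linarith

/-- **¬H⋆₃[LIN] at every genuine datum with an unramified odd BAD place carrying `m_q ≥ 1`** (the label `j = 2` exists: `l⋆ ≥ 2`). [folklore] -/
theorem not_hStarLin_pilotDataOfK_of_unramified_odd (pp : Nat.Primes) (hp : 2 < (pp : ℕ))
    (w : (thetaIndex (pilotDataOfK D K)).Fibre (.inr pp)) {m : ℕ} (hm : 1 ≤ m)
    (hw : haveI : Fact (pp : ℕ).Prime := ⟨pp.2⟩; placeOf (pilotDataOfK D K) pp.1 w ∈ (pilotDataOfK D K).S)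
    (hram : haveI : Fact (pp : ℕ).Prime := ⟨pp.2⟩; (placeOf (pilotDataOfK D K) pp.1 w).asIdeal.ramificationIdx ℤ = 1)
    (hP : haveI : Fact (pp : ℕ).Prime := ⟨pp.2⟩; (pilotDataOfK D K).qPilot (placeOf (pilotDataOfK D K) pp.1 w) = (m : ℝ)) :
    ¬ HStarLin (pilotDataOfK D K) := by
  have hl : 1 < (thetaIndex (pilotDataOfK D K)).lstar := by
    show 1 < (pilotDataOfK D K).lstar
    exact (pilotDataOfK D K).two_le_lstar
  intro h
  exact not_cellLinAt_pilotDataOfK_of_unramified_odd D pp hp ⟨1, hl⟩ le_rfl w hm hram hP (h pp w hw ⟨1, hl⟩)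

/-- **H⋆₃[ED] CELL FAILS on the unramified odd stratum from label `j = 3` on**: at a place `w | p` of the genuine datum with `p > 2`, `e(w|p) = 1`,
`P_q(w) = m ≥ 1`, every label `j = i₀ + 1 ≥ 3` has `¬ CellAt` (the cell reads `⌊j²m − (j+1)⌋ ≤ m`, i.e. `(j−1)·m ≤ 1`; at `j = 2` it holds iff `m = 1`). [folklore] -/
theorem not_cellAt_pilotDataOfK_of_unramified_odd (pp : Nat.Primes) (hp : 2 < (pp : ℕ))
    (i₀ : Fin (thetaIndex (pilotDataOfK D K)).lstar) (hi : 2 ≤ (i₀ : ℕ))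
    (w : (thetaIndex (pilotDataOfK D K)).Fibre (.inr pp)) {m : ℕ} (hm : 1 ≤ m)
    (hram : haveI : Fact (pp : ℕ).Prime := ⟨pp.2⟩; (placeOf (pilotDataOfK D K) pp.1 w).asIdeal.ramificationIdx ℤ = 1)
    (hP : haveI : Fact (pp : ℕ).Prime := ⟨pp.2⟩; (pilotDataOfK D K).qPilot (placeOf (pilotDataOfK D K) pp.1 w) = (m : ℝ)) :
    ¬ CellAt (pilotDataOfK D K) hlog pp i₀ w := by
  haveI hF : Fact (pp : ℕ).Prime := ⟨pp.2⟩
  have hnd : ¬ (pp : ℕ) ∣ 1 := by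
    intro h
    have := Nat.le_of_dvd one_pos h
    omega
  have hp2 : (pp : ℕ) ≠ 2 := by omega
  rw [cellAt_pilotDataOfK_iff_of_not_dvd D hlog pp i₀ w hram hnd hP]
  have h1 : (1 : ℕ) ≤ (pp : ℕ) - 2 := by omega
  rw [logRadiusA_eq hp le_rfl h1, logRadiusB_eq hp le_rfl h1, if_neg hp2]
  have hi' : (2 : ℝ) ≤ ((i₀ : ℕ) : ℝ) := by exact_mod_cast hi
  have hm' : (1 : ℝ) ≤ (m : ℝ) := by exact_mod_cast hm
  simp only [Nat.cast_one, div_one, sub_self, zero_add]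
  intro h
  set x : ℝ := (((i₀ : ℕ) + 1 : ℕ) : ℝ) ^ 2 * (m : ℝ) - ((i₀ : ℕ) + 2 : ℝ) * (1 : ℝ) with hx
  have hfl : x - 1 < (⌊x⌋ : ℝ) := Int.sub_one_lt_floor x
  have h8 : (8 : ℝ) ≤ (((i₀ : ℕ) + 1 : ℕ) : ℝ) ^ 2 - 1 := by push_cast; nlinarith
  have h9 : ((((i₀ : ℕ) + 1 : ℕ) : ℝ) ^ 2 - 1) * 1 ≤ ((((i₀ : ℕ) + 1 : ℕ) : ℝ) ^ 2 - 1) * (m : ℝ) :=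
    mul_le_mul_of_nonneg_left hm' (by linarith)
  have h10 : (((i₀ : ℕ) : ℝ) + 3) ≤ (((i₀ : ℕ) + 1 : ℕ) : ℝ) ^ 2 - 1 := by push_cast; nlinarith
  push_cast at h hfl h9 h10 hx
  nlinarith [h, hfl, h9, h10]

/-- **¬H⋆₃[ED] at every genuine datum with an unramified odd BAD place carrying `m_q ≥ 1`, once `l⋆ ≥ 3`** (the label `j = 3` exists). [folklore] -/
theorem not_hStar_pilotDataOfK_of_unramified_odd (hl : 3 ≤ (pilotDataOfK D K).lstar) (pp : Nat.Primes) (hp : 2 < (pp : ℕ))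
    (w : (thetaIndex (pilotDataOfK D K)).Fibre (.inr pp)) {m : ℕ} (hm : 1 ≤ m)
    (hw : haveI : Fact (pp : ℕ).Prime := ⟨pp.2⟩; placeOf (pilotDataOfK D K) pp.1 w ∈ (pilotDataOfK D K).S)
    (hram : haveI : Fact (pp : ℕ).Prime := ⟨pp.2⟩; (placeOf (pilotDataOfK D K) pp.1 w).asIdeal.ramificationIdx ℤ = 1)
    (hP : haveI : Fact (pp : ℕ).Prime := ⟨pp.2⟩; (pilotDataOfK D K).qPilot (placeOf (pilotDataOfK D K) pp.1 w) = (m : ℝ)) :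
    ¬ HStar (pilotDataOfK D K) hlog := by
  have hl' : 2 < (thetaIndex (pilotDataOfK D K)).lstar := by
    show 2 < (pilotDataOfK D K).lstar
    exact hl
  intro h
  exact not_cellAt_pilotDataOfK_of_unramified_odd D hlog pp hp ⟨2, hl'⟩ le_rfl w hm hram hP (h pp w hw ⟨2, hl'⟩)

end Genuine

/-! ## §3. Same sign as the family, through the row's own glue: `¬Licence` at such a datum (realising ideles) -/

section Necessity

variable {F K Fbar : Type} [Field F] [NumberField F] [Field K] [NumberField K] [Algebra F K] [Field Fbar]
  [Algebra F Fbar] [Algebra K Fbar] {E : WeierstrassCurve F} [E.IsElliptic] {l : ℕ} {Pb : BadPlacePredicates K}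
  (D : InitialThetaData F K Fbar E l Pb) {logv : PadicLogs K} (hlog : LogvAnalytic logv)
  (M : Type) [Field M] [NumberField M]
  (archPk : ∀ (j : (thetaIndex (pilotDataOfK D K)).Label) (vQ : (thetaIndex (pilotDataOfK D K)).VQ),
    Set ((logShellsDH (pilotDataOfK D K) logv).Packet j vQ))
  (archSub : ∀ (j : (thetaIndex (pilotDataOfK D K)).Label) (v : (thetaIndex (pilotDataOfK D K)).V),
    Set ((logShellsDH (pilotDataOfK D K) logv).Packet j ((thetaIndex (pilotDataOfK D K)).over v)))
  (Ψ : ℤ → ∀ v : (thetaIndex (pilotDataOfK D K)).V, v ∈ (thetaIndex (pilotDataOfK D K)).Vbad →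
    Set ((logShellsDH (pilotDataOfK D K) logv).StarPacket v))
  (act : ℤ → ∀ v : (thetaIndex (pilotDataOfK D K)).V, v ∈ (thetaIndex (pilotDataOfK D K)).Vbad →
    (logShellsDH (pilotDataOfK D K) logv).StarPacket v → Module.End ℚ ((logShellsDH (pilotDataOfK D K) logv).StarPacket v))
  (Mmod : ℤ → ∀ j : (thetaIndex (pilotDataOfK D K)).LabelStar, Set ((logShellsDH (pilotDataOfK D K) logv).GlobalPacket j.1))
  (region : ℤ → ∀ j : (thetaIndex (pilotDataOfK D K)).LabelStar, FinDivisor M → ∀ vQ : (thetaIndex (pilotDataOfK D K)).VQ,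
    Set ((logShellsDH (pilotDataOfK D K) logv).Packet j.1 vQ))
  (n : ℤ) {HT : Type} {LogLink : HT → HT → Type} {IsFull : ∀ {s t : HT}, LogLink s t → Prop}
  (lat : LGPGaussianLogThetaLattice LogLink IsFull)
  {Frd : Type} {IsoF : Frd → Frd → Type} {Ob : Frd → Type} {realify : Frd → Frd} {Strip : Type}
  {IsoS : Strip → Strip → Type} {Mv : ∀ v : (thetaIndex (pilotDataOfK D K)).V, v ∈ (thetaIndex (pilotDataOfK D K)).Vbad → Type}
  [∀ v h, Monoid (Mv v h)]
  (sig : GlobalLGPFrobenioidSignature (thetaIndex (pilotDataOfK D K)).lstar (thetaIndex (pilotDataOfK D K)).V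
    (· ∈ (thetaIndex (pilotDataOfK D K)).Vbad) Frd IsoF Ob realify Strip IsoS Mv)
  (split : SplittingMonoids Mv) {ObΔ : Type} {N : ∀ v : (thetaIndex (pilotDataOfK D K)).V, v ∈ (thetaIndex (pilotDataOfK D K)).Vbad → Type}
  [∀ v h, Monoid (N v h)] (qData : QPilotData ObΔ N)
  (tq : ∀ (pp : Nat.Primes) (x : (thetaIndex (pilotDataOfK D K)).Fibre (.inr pp)),
    haveI : Fact (pp : ℕ).Prime := ⟨pp.2⟩; kOf (pilotDataOfK D K) pp.1 x)
  (t : ∀ (pp : Nat.Primes) (_ : Fin (pilotDataOfK D K).lstar) (x : (thetaIndex (pilotDataOfK D K)).Fibre (.inr pp)),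
    haveI : Fact (pp : ℕ).Prime := ⟨pp.2⟩; kOf (pilotDataOfK D K) pp.1 x)
  (htq0 : ∀ pp x, tq pp x ≠ 0)
  (htq1 : ∀ (pp : Nat.Primes) (x : (thetaIndex (pilotDataOfK D K)).Fibre (.inr pp)),
    haveI : Fact (pp : ℕ).Prime := ⟨pp.2⟩; placeOf (pilotDataOfK D K) pp.1 x ∉ (pilotDataOfK D K).S → ‖tq pp x‖ = 1)
  (col : ℤ → Column (logShellsDH (pilotDataOfK D K) logv))
  (ht0 : ∀ pp i x, t pp i x ≠ 0)
  (ht : ∀ (pp : Nat.Primes) (i : Fin (pilotDataOfK D K).lstar) (x : (thetaIndex (pilotDataOfK D K)).Fibre (.inr pp)),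
    haveI : Fact (pp : ℕ).Prime := ⟨pp.2⟩
    Real.log ‖t pp i x‖ = -((pilotDataOfK D K).thetaPilot i (placeOf (pilotDataOfK D K) pp.1 x)) *
      logNorm K (placeOf (pilotDataOfK D K) pp.1 x) / localDegree K (placeOf (pilotDataOfK D K) pp.1 x))
  (htq : ∀ (pp : Nat.Primes) (x : (thetaIndex (pilotDataOfK D K)).Fibre (.inr pp)),
    haveI : Fact (pp : ℕ).Prime := ⟨pp.2⟩
    Real.log ‖tq pp x‖ = -((pilotDataOfK D K).qPilot (placeOf (pilotDataOfK D K) pp.1 x)) *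
      logNorm K (placeOf (pilotDataOfK D K) pp.1 x) / localDegree K (placeOf (pilotDataOfK D K) pp.1 x))

include ht0 ht htq in
/-- **The (xi-f) licence at `settingPrVolSharp (pilotDataOfK D K) …` with REALISING ideles is refuted at every genuine datum having an unramified odd bad
place that carries `m_q ≥ 1`** — derived through H⋆₃[LIN]'s necessity glue (p459252 `not_licence_of_not_cellLinAt` at the label `j = 2`): the row REPRODUCES
the unramified-odd refutation family's verdict on that stratum. [cite: Mochizuki2012, IUTchIV Prop. 1.2 (i)(ii) pp. 10–11] [claim: Mochizuki2012, status: disputed] -/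
theorem not_licence_settingPrVolSharp_of_unramified_odd (pp : Nat.Primes) (hp : 2 < (pp : ℕ))
    (w : (thetaIndex (pilotDataOfK D K)).Fibre (.inr pp)) {m : ℕ} (hm : 1 ≤ m)
    (hram : haveI : Fact (pp : ℕ).Prime := ⟨pp.2⟩; (placeOf (pilotDataOfK D K) pp.1 w).asIdeal.ramificationIdx ℤ = 1)
    (hP : haveI : Fact (pp : ℕ).Prime := ⟨pp.2⟩; (pilotDataOfK D K).qPilot (placeOf (pilotDataOfK D K) pp.1 w) = (m : ℝ)) :
    ¬ Thm311ToCor312.Licence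
        (settingPrVolSharp (pilotDataOfK D K) hlog M archPk archSub Ψ act Mmod region n lat sig split qData tq t htq0 htq1) := by
  have hl : 1 < (thetaIndex (pilotDataOfK D K)).lstar := by
    show 1 < (pilotDataOfK D K).lstar
    exact (pilotDataOfK D K).two_le_lstar
  exact not_licence_of_not_cellLinAt D hlog M archPk archSub Ψ act Mmod region n lat sig split qData tq t htq0 htq1 ht0 ht htq pp ⟨1, hl⟩ w
    (not_cellLinAt_pilotDataOfK_of_unramified_odd D pp hp ⟨1, hl⟩ le_rfl w hm hram hP)

end Necessity

end Summit.ABC.IUTFork.Repair.RHHullCapacityNecessaryLinUnram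

end
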